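import Literature.Topology.PlaneTopology.Crosscut
import HarnessLib

/-!
# Simple arcs in the plane: normal form, reversal, gluing

Topic: Topology / plane topology (companion to `Crosscut.lean`). Elementary closure properties
of the predicate `Literature.IsSimpleArc L a b` ("`L` is a simple arc from `a` to `b`": the injective
continuous image of `[0, 1]`, Newman, *Elements of the topology of plane sets of points*
(1939), Ch. III–V) needed to manufacture cross-cuts of a Jordan domain out of polygonal lattice
paths:

* `isSimpleArc_iff_continuous`: the parametrisation may be taken continuous on all of `ℝ`
  (extend constantly outside `[0, 1]`, Mathlib's `Set.IccExtend`);
* `IsSimpleArc.ne`: the end-points differ; `IsSimpleArc.symm`: reversal;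
* `IsSimpleArc.image`: images under continuous injections of `ℂ` (e.g. similarities);
* **gluing** `IsSimpleArc.union`: an arc from `a` to `b` followed by an arc from `b` to `c`
  meeting it only at `b` is an arc from `a` to `c` (Newman 1939, Ch. III §1, "the sum of two
  simple arcs with only an end-point in common is a simple arc").

Mathlib anchors: `Set.IccExtend`, `Continuous.if_le`, `Set.InjOn`, `segment`.
Mathlib has `Path`/`JoinedIn` but no notion of *simple* (injective) arc and no such gluing
lemma for injective paths.

## References
* M. H. A. Newman, *Elements of the topology of plane sets of points*, Cambridge Univ. Press
  (1939), Ch. III §1, Ch. V §11. [Newman1939]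
-/

namespace Literature.Topology.PlaneTopology

open Set _root_.Topology

noncomputable section

namespace IsSimpleArc

variable {L L₁ L₂ : Set ℂ} {a b c : ℂ}

/-- **Normal form**: a simple arc admits a parametrisation continuous on all of `ℝ` (constant
outside `[0, 1]`). [folklore] -/
theorem _root_.Literature.Topology.PlaneTopology.isSimpleArc_iff_continuous :
    IsSimpleArc L a b ↔ ∃ γ : ℝ → ℂ, Continuous γ ∧ InjOn γ (Icc 0 1) ∧ γ '' Icc 0 1 = L ∧
      γ 0 = a ∧ γ 1 = b := by
  constructor
  · rintro ⟨γ, hγ, hinj, hL, h0, h1⟩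
    refine ⟨IccExtend zero_le_one (fun t : Icc (0 : ℝ) 1 => γ t), ?_, ?_, ?_, ?_, ?_⟩
    · exact (hγ.restrict.Icc_extend' : _)
    · intro s hs t ht hst
      rw [IccExtend_of_mem _ _ hs, IccExtend_of_mem _ _ ht] at hst
      exact hinj hs ht hst
    · rw [← hL]
      refine image_congr fun t ht => ?_
      exact IccExtend_of_mem _ _ ht
    · rw [IccExtend_of_mem _ _ (left_mem_Icc.2 zero_le_one)]; exact h0
    · rw [IccExtend_of_mem _ _ (right_mem_Icc.2 zero_le_one)]; exact h1
  · rintro ⟨γ, hγ, hinj, hL, h0, h1⟩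
    exact ⟨γ, hγ.continuousOn, hinj, hL, h0, h1⟩

/-- The end-points of a simple arc are distinct. [folklore] -/
theorem ne (h : IsSimpleArc L a b) : a ≠ b := by
  obtain ⟨γ, -, hinj, -, h0, h1⟩ := h
  rw [← h0, ← h1]
  intro h
  have := hinj (left_mem_Icc.2 zero_le_one) (right_mem_Icc.2 zero_le_one) h
  norm_num at this

/-- **Reversal**: a simple arc from `a` to `b` is a simple arc from `b` to `a`. [folklore] -/
theorem symm (h : IsSimpleArc L a b) : IsSimpleArc L b a := by
  obtain ⟨γ, hγ, hinj, hL, h0, h1⟩ := isSimpleArc_iff_continuous.1 h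
  refine isSimpleArc_iff_continuous.2 ⟨fun t => γ (1 - t), hγ.comp (by fun_prop), ?_, ?_, ?_, ?_⟩
  · intro s hs t ht hst
    have := hinj ⟨by linarith [hs.2], by linarith [hs.1]⟩ ⟨by linarith [ht.2], by linarith [ht.1]⟩ hst
    linarith
  · rw [← hL]
    ext z
    constructor
    · rintro ⟨t, ht, rfl⟩
      exact ⟨1 - t, ⟨by linarith [ht.2], by linarith [ht.1]⟩, rfl⟩
    · rintro ⟨t, ht, rfl⟩
      exact ⟨1 - t, ⟨by linarith [ht.2], by linarith [ht.1]⟩, by simp⟩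
  · simp [h1]
  · simp [h0]

/-- **Images**: the image of a simple arc under a continuous injection of the plane (e.g. a
similarity `z ↦ δ z + τ`) is a simple arc. [folklore] -/
theorem image (h : IsSimpleArc L a b) {f : ℂ → ℂ} (hf : Continuous f) (hfi : Function.Injective f) :
    IsSimpleArc (f '' L) (f a) (f b) := by
  obtain ⟨γ, hγ, hinj, hL, h0, h1⟩ := isSimpleArc_iff_continuous.1 h
  refine isSimpleArc_iff_continuous.2 ⟨f ∘ γ, hf.comp hγ, hfi.comp_injOn hinj, ?_, by simp [h0],
    by simp [h1]⟩
  rw [image_comp, hL]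

/-- **Gluing of simple arcs** (Newman 1939, Ch. III §1): an arc `L₁` from `a` to `b` and an arc
`L₂` from `b` to `c` with `L₁ ∩ L₂ ⊆ {b}` form an arc `L₁ ∪ L₂` from `a` to `c`.
[cite: Newman1939, Ch. III §1] -/
theorem union (h₁ : IsSimpleArc L₁ a b) (h₂ : IsSimpleArc L₂ b c) (h : L₁ ∩ L₂ ⊆ {b}) :
    IsSimpleArc (L₁ ∪ L₂) a c := by
  obtain ⟨γ₁, hγ₁, hinj₁, hL₁, h0₁, h1₁⟩ := isSimpleArc_iff_continuous.1 h₁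
  obtain ⟨γ₂, hγ₂, hinj₂, hL₂, h0₂, h1₂⟩ := isSimpleArc_iff_continuous.1 h₂
  set γ : ℝ → ℂ := fun t => if t ≤ 1 / 2 then γ₁ (2 * t) else γ₂ (2 * t - 1) with hγ
  have hcont : Continuous γ := by
    refine Continuous.if_le (hγ₁.comp (by fun_prop)) (hγ₂.comp (by fun_prop)) continuous_id
      continuous_const ?_
    rintro t rfl
    norm_num [h1₁, h0₂]
  -- values on the two halves
  have hγl : ∀ t, t ≤ 1 / 2 → γ t = γ₁ (2 * t) := fun t ht => by
    show (if t ≤ 1 / 2 then γ₁ (2 * t) else γ₂ (2 * t - 1)) = _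
    rw [if_pos ht]
  have hγr : ∀ t, 1 / 2 ≤ t → γ t = γ₂ (2 * t - 1) := fun t ht => by
    show (if t ≤ 1 / 2 then γ₁ (2 * t) else γ₂ (2 * t - 1)) = _
    rcases ht.eq_or_lt with rfl | ht
    · rw [if_pos le_rfl]; norm_num [h1₁, h0₂]
    · rw [if_neg (not_le.2 ht)]
  -- points of the two halves in the two arcs
  have hmem₁ : ∀ t ∈ Icc (0 : ℝ) 1, t ≤ 1 / 2 → γ t ∈ L₁ := fun t ht ht' => by
    rw [hγl t ht', ← hL₁]; exact mem_image_of_mem _ ⟨by linarith [ht.1], by linarith⟩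
  have hmem₂ : ∀ t ∈ Icc (0 : ℝ) 1, 1 / 2 ≤ t → γ t ∈ L₂ := fun t ht ht' => by
    rw [hγr t ht', ← hL₂]; exact mem_image_of_mem _ ⟨by linarith, by linarith [ht.2]⟩
  -- a point of both arcs is `b`, at parameter `1/2` on either side
  have hb₁ : ∀ t ∈ Icc (0 : ℝ) 1, t ≤ 1 / 2 → γ t = b → t = 1 / 2 := by
    intro t ht ht' hb
    rw [hγl t ht', ← h1₁] at hb
    have := hinj₁ ⟨by linarith [ht.1], by linarith⟩ (right_mem_Icc.2 zero_le_one) hb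
    linarith
  have hb₂ : ∀ t ∈ Icc (0 : ℝ) 1, 1 / 2 ≤ t → γ t = b → t = 1 / 2 := by
    intro t ht ht' hb
    rw [hγr t ht', ← h0₂] at hb
    have := hinj₂ ⟨by linarith, by linarith [ht.2]⟩ (left_mem_Icc.2 zero_le_one) hb
    linarith
  refine isSimpleArc_iff_continuous.2 ⟨γ, hcont, ?_, ?_, ?_, ?_⟩
  · -- injectivity
    intro s hs t ht hst
    rcases le_total s (1 / 2) with hs' | hs' <;> rcases le_total t (1 / 2) with ht' | ht'
    · rw [hγl s hs', hγl t ht'] at hst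
      have := hinj₁ ⟨by linarith [hs.1], by linarith⟩ ⟨by linarith [ht.1], by linarith⟩ hst
      linarith
    · have hsb : γ s = b := by
        have : γ s ∈ L₁ ∩ L₂ := ⟨hmem₁ s hs hs', hst ▸ hmem₂ t ht ht'⟩
        exact h this
      rw [hb₁ s hs hs' hsb, hb₂ t ht ht' (hst ▸ hsb)]
    · have hsb : γ s = b := by
        have : γ s ∈ L₁ ∩ L₂ := ⟨hst ▸ hmem₁ t ht ht', hmem₂ s hs hs'⟩
        exact h this
      rw [hb₂ s hs hs' hsb, hb₁ t ht ht' (hst ▸ hsb)]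
    · rw [hγr s hs', hγr t ht'] at hst
      have := hinj₂ ⟨by linarith, by linarith [hs.2]⟩ ⟨by linarith, by linarith [ht.2]⟩ hst
      linarith
  · -- image
    apply Subset.antisymm
    · rintro _ ⟨t, ht, rfl⟩
      rcases le_total t (1 / 2) with ht' | ht'
      · exact Or.inl (hmem₁ t ht ht')
      · exact Or.inr (hmem₂ t ht ht')
    · rintro z (hz | hz)
      · rw [← hL₁] at hz
        obtain ⟨u, hu, rfl⟩ := hz
        refine ⟨u / 2, ⟨by linarith [hu.1], by linarith [hu.2]⟩, ?_⟩
        rw [hγl _ (by linarith [hu.2])]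
        congr 1; ring
      · rw [← hL₂] at hz
        obtain ⟨u, hu, rfl⟩ := hz
        refine ⟨(u + 1) / 2, ⟨by linarith [hu.1], by linarith [hu.2]⟩, ?_⟩
        rw [hγr _ (by linarith [hu.1])]
        congr 1; ring
  · rw [hγl 0 (by norm_num), mul_zero, h0₁]
  · rw [hγr 1 (by norm_num)]; norm_num [h1₂]

/-- Gluing, with the intersection hypothesis in the form "`L₁ ∩ L₂ = {b}`". [folklore] -/
theorem union' (h₁ : IsSimpleArc L₁ a b) (h₂ : IsSimpleArc L₂ b c) (h : L₁ ∩ L₂ = {b}) :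
    IsSimpleArc (L₁ ∪ L₂) a c :=
  h₁.union h₂ h.le

/-- **Sub-segments**: for `a ≠ b` and `t ∈ (0, 1]`, the initial piece `[a, a + t (b - a)]` of
the segment `[a, b]` is a simple arc. [folklore] -/
theorem subsegment {a b : ℂ} (hab : a ≠ b) {t : ℝ} (ht : 0 < t) :
    IsSimpleArc (_root_.segment ℝ a (a + t • (b - a))) a (a + t • (b - a)) := by
  refine IsSimpleArc.segment fun h => hab ?_
  have : t • (b - a) = 0 := by
    have h' := congrArg (· - a) h
    simpa using h'.symm
  rw [smul_eq_zero] at this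
  rcases this with h | h
  · exact absurd h ht.ne'
  · exact (sub_eq_zero.1 h).symm

end IsSimpleArc

end

end Literature.Topology.PlaneTopology
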